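import Summits.Parity.BatemanHorn.Theorems.SoloInformedHooleyShiftHypothesis

/-!
# The trapezoid form: averaging the cut-off removes the shifts

Informed soloist `solo-Parity-informed` (session 143), conjunct `BatemanHorn`, the `d ≥ 3` rung BELOW the parity
wall (Erdős 1952: `S_g(x) = ∑_{n≤x} τ(g(n)) ~ d·A_g·x log x` for an irreducible `g` of degree `d ≥ 3`).

`SoloInformedSmoothHyperbolaReduction` + `SoloInformedSmoothHyperbolaFourier` reduce Erdős's asymptotics to the
cancellation of the EXACT trilinear form `Mid^w_g(x) − H^w_g(x; E) = ∑_{x<e≤E} e⁻¹ ∑_{0<h<e} Φ_e(h) S_g(h; e)` with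
the kernel `Φ_e(h) = ∑_{m≤x} a_e(m) e(−hm/e)`; the SHARP cut-off `m ≤ x` is what forces the SHIFTED Hooley sums
`S^{(b)}_g` (`b = x + 1`) of `SoloInformedHooleyShiftHypothesis`. Here the cut-off is AVERAGED: summing the form
over `x' ∈ (X₀, X₀ + D]` replaces the indicator of `m ≤ x'` by the TRAPEZOID count
`W(m) = #{x' ∈ (X₀, X₀+D] : m ≤ x'}` (`= D` for `m ≤ X₀ + 1`, decreasing by `1` per step to `0` at `m = X₀+D+1`),
whose first differences are `≤ 1 = W(1)/D·…` — no jump, hence (after two Abel summations in `m`, later files) no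
boundary term and NO SHIFTS.

This file proves the exact bookkeeping:

* `sum_Ioc_smooth_sub_heur_eq` — for `E ≥ X₁ := X₀ + D` admissible,
  `∑_{X₀<x'≤X₁} (Mid^w_g(x') − H^w_g(x'; E)) = Low + ∑_{X₁<e≤E} t^W_e`, where `|Low| ≤ D·∑_{e≤X₁} ρ_g(e)`
  (`abs_trapLow_le`; the moduli `e ≤ X₁` carry at most `ρ_g(e)` each) and
  `t^W_e = ∑_{ν ∈ R_e ∩ [1,X₁]} W(ν)a_e(ν) − (ρ_g(e)/e)∑_{m≤X₁} W(m)a_e(m) = e⁻¹∑_{0<h<e} K_e(h)·S_g(h; e)`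
  (`trapLevel_eq_fourier`) with the UNSHIFTED Hooley sums and the trapezoid kernel
  `K_e(h) = ∑_{m ≤ X₁} W(m)a_e(m)e(−hm/e)` (`trapKernel`);
* the elementary facts on `W` (`trapCount_*`: `W ≤ D`, `W = D` up to `X₀+1`, then decreasing by exactly one per
  step to `0`) used by the sequel's Abel summations.

The deduction `TrapezoidCancellation → ErdosDivisorSumAsymptotic` (combination with the hyperbola pairing and a
monotone sandwich) is `SoloInformedTrapezoidReduction`; the analytic treatment of `K_e(h)` (second-order Abel
summation in `m`, `SoloInformedAbelKernel`) comes after. Nothing here moves a wall row; verdict NO PATH unchanged.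
-/

namespace Summit.Parity.BatemanHorn.Theorems

open Finset Polynomial Filter Topology
open Literature.NumberTheory.Sieve (polyRootCountMod exists_sum_rootCount_le)

/-! ### The trapezoid count -/

/-- `W(m) = #{x' ∈ (X₀, X₀ + D] : m ≤ x'}`. [this work] -/
def trapCount (X₀ D m : ℕ) : ℕ := #((Ioc X₀ (X₀ + D)).filter fun x' => m ≤ x')

/-- `W(m) ≤ D`. [this work] -/
theorem trapCount_le (X₀ D m : ℕ) : trapCount X₀ D m ≤ D := by
  unfold trapCount
  refine (card_filter_le _ _).trans ?_
  rw [Nat.card_Ioc, Nat.add_sub_cancel_left]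

/-- `W(m) = D` for `m ≤ X₀ + 1`. [this work] -/
theorem trapCount_of_le_succ {X₀ D m : ℕ} (hm : m ≤ X₀ + 1) : trapCount X₀ D m = D := by
  unfold trapCount
  rw [filter_true_of_mem fun x' hx' => hm.trans (Nat.succ_le_of_lt (mem_Ioc.mp hx').1), Nat.card_Ioc,
    Nat.add_sub_cancel_left]

/-- `W(m) = 0` for `m > X₀ + D`. [this work] -/
theorem trapCount_of_lt {X₀ D m : ℕ} (hm : X₀ + D < m) : trapCount X₀ D m = 0 := by
  unfold trapCount
  rw [card_eq_zero, filter_eq_empty_iff]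
  intro x' hx'
  have := (mem_Ioc.mp hx').2
  omega

/-- `W(m) = X₀ + D + 1 − m` for `X₀ < m`. [this work] -/
theorem trapCount_of_lt_left {X₀ D m : ℕ} (hm : X₀ < m) : trapCount X₀ D m = X₀ + D + 1 - m := by
  unfold trapCount
  have h : (Ioc X₀ (X₀ + D)).filter (fun x' => m ≤ x') = Icc m (X₀ + D) := by
    ext x'
    simp only [mem_filter, mem_Ioc, mem_Icc]
    omega
  rw [h, Nat.card_Icc]

/-- The step relation `W(m) = W(m+1) + [X₀ < m ≤ X₀ + D]`: `W` decreases by at most one per step. [this work] -/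
theorem trapCount_eq_succ_add (X₀ D m : ℕ) :
    trapCount X₀ D m = trapCount X₀ D (m + 1) + if m ∈ Ioc X₀ (X₀ + D) then 1 else 0 := by
  unfold trapCount
  have hsplit : (Ioc X₀ (X₀ + D)).filter (fun x' => m ≤ x')
      = (Ioc X₀ (X₀ + D)).filter (fun x' => m + 1 ≤ x') ∪ (Ioc X₀ (X₀ + D)).filter (fun x' => x' = m) := by
    ext x'
    simp only [mem_filter, mem_union, mem_Ioc]
    omega
  have hdisj : Disjoint ((Ioc X₀ (X₀ + D)).filter (fun x' => m + 1 ≤ x'))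
      ((Ioc X₀ (X₀ + D)).filter (fun x' => x' = m)) := by
    rw [disjoint_filter]
    intro x' _ h1 h2
    omega
  rw [hsplit, card_union_of_disjoint hdisj]
  congr 1
  by_cases hm : m ∈ Ioc X₀ (X₀ + D)
  · rw [if_pos hm, filter_eq' _ m, if_pos hm, card_singleton]
  · rw [if_neg hm, filter_eq' _ m, if_neg hm, card_empty]

/-- `W` is antitone: `W(m+1) ≤ W(m)`. [this work] -/
theorem trapCount_succ_le (X₀ D m : ℕ) : trapCount X₀ D (m + 1) ≤ trapCount X₀ D m := by
  rw [trapCount_eq_succ_add X₀ D m]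
  exact Nat.le_add_right _ _

/-- `W(m) − W(m+1) ≤ 1`. [this work] -/
theorem trapCount_sub_succ_le (X₀ D m : ℕ) : trapCount X₀ D m - trapCount X₀ D (m + 1) ≤ 1 := by
  rw [trapCount_eq_succ_add X₀ D m]
  split_ifs <;> omega

/-! ### The trapezoid kernel and the per-level terms -/

/-- The TRAPEZOID KERNEL `K_e(h) = ∑_{1 ≤ m ≤ X₀+D} W(m)·a_e(m)·e(−hm/e)`. [this work] -/
noncomputable def trapKernel (g : ℤ[X]) (Δ : ℝ) (X₀ D e : ℕ) (h : ℤ) : ℂ :=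
  ∑ m ∈ Icc 1 (X₀ + D), (((trapCount X₀ D m : ℝ) * locWeight g Δ e m : ℝ) : ℂ) * eAdd e (-(h * m))

/-- `K_e(0) = ∑_{m ≤ X₀+D} W(m)a_e(m)`. [this work] -/
theorem trapKernel_zero (g : ℤ[X]) (Δ : ℝ) (X₀ D e : ℕ) :
    trapKernel g Δ X₀ D e 0 = ∑ m ∈ Icc 1 (X₀ + D), (((trapCount X₀ D m : ℝ) * locWeight g Δ e m : ℝ) : ℂ) := by
  unfold trapKernel
  exact sum_congr rfl fun m _ => by rw [zero_mul, neg_zero, eAdd_zero, mul_one]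

/-- The trivial bound `|K_e(h)| ≤ D·(X₀ + D)`. [this work] -/
theorem norm_trapKernel_le (g : ℤ[X]) (Δ : ℝ) (X₀ D e : ℕ) (h : ℤ) :
    ‖trapKernel g Δ X₀ D e h‖ ≤ (D : ℝ) * (X₀ + D : ℕ) := by
  unfold trapKernel
  calc ‖∑ m ∈ Icc 1 (X₀ + D), (((trapCount X₀ D m : ℝ) * locWeight g Δ e m : ℝ) : ℂ) * eAdd e (-(h * m))‖
      ≤ ∑ m ∈ Icc 1 (X₀ + D), ‖(((trapCount X₀ D m : ℝ) * locWeight g Δ e m : ℝ) : ℂ) * eAdd e (-(h * m))‖ :=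
        norm_sum_le _ _
    _ ≤ ∑ m ∈ Icc 1 (X₀ + D), (D : ℝ) := by
        refine sum_le_sum fun m _ => ?_
        rw [norm_mul, norm_eAdd, mul_one, Complex.norm_real, Real.norm_eq_abs,
          abs_of_nonneg (mul_nonneg (Nat.cast_nonneg _) (locWeight_nonneg g Δ e m))]
        calc (trapCount X₀ D m : ℝ) * locWeight g Δ e m ≤ (trapCount X₀ D m : ℝ) * 1 :=
              mul_le_mul_of_nonneg_left (locWeight_le_one g Δ e m) (Nat.cast_nonneg _)
          _ ≤ D := by rw [mul_one]; exact_mod_cast trapCount_le X₀ D m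
    _ = (D : ℝ) * (X₀ + D : ℕ) := by
        rw [sum_const, Nat.card_Icc, nsmul_eq_mul, mul_comm]
        congr 1

/-- The per-level term of the smooth located form at height `x'`:
`t_e(x') = ∑_{ν ∈ R_e ∩ [1,x']} a_e(ν) − (ρ_g(e)/e)·∑_{n ≤ x'} a_e(n)`. [this work] -/
noncomputable def levelTerm (g : ℤ[X]) (Δ : ℝ) (e x' : ℕ) : ℝ :=
  ∑ ν ∈ rootResidues g e ∩ Icc 1 x', locWeight g Δ e ν
    - (polyRootCountMod ![g] e : ℝ) / e * ∑ n ∈ Icc 1 x', locWeight g Δ e n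

/-- `Mid^w_g(x) − H^w_g(x; E) = ∑_{x<e≤E} t_e(x)`. [this work] -/
theorem polySmoothMid_sub_heur_eq_sum_levelTerm (g : ℤ[X]) (Δ : ℝ) {x E : ℕ}
    (hg0 : ∀ n ∈ Icc 1 x, g.eval (n : ℤ) ≠ 0) (hE : ∀ n ∈ Icc 1 x, (g.eval (n : ℤ)).natAbs ≤ E) :
    polySmoothMid g Δ x - polySmoothHeur g Δ x E = ∑ e ∈ Ioc x E, levelTerm g Δ e x := by
  rw [polySmoothMid_eq_sum g Δ hg0 hE, polySmoothHeur, ← sum_sub_distrib]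
  rfl

/-- `|t_e(x)| ≤ ρ_g(e)` for `x < e`. [this work] -/
theorem abs_levelTerm_le (g : ℤ[X]) (Δ : ℝ) {e x : ℕ} (hxe : x < e) :
    |levelTerm g Δ e x| ≤ polyRootCountMod ![g] e := by
  unfold levelTerm
  have hA0 : 0 ≤ ∑ ν ∈ rootResidues g e ∩ Icc 1 x, locWeight g Δ e ν :=
    sum_nonneg fun ν _ => locWeight_nonneg g Δ e ν
  have hA : ∑ ν ∈ rootResidues g e ∩ Icc 1 x, locWeight g Δ e ν ≤ polyRootCountMod ![g] e := by
    calc ∑ ν ∈ rootResidues g e ∩ Icc 1 x, locWeight g Δ e ν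
        ≤ ∑ ν ∈ rootResidues g e ∩ Icc 1 x, (1 : ℝ) := sum_le_sum fun ν _ => locWeight_le_one g Δ e ν
      _ = #(rootResidues g e ∩ Icc 1 x) := by rw [sum_const, nsmul_eq_mul, mul_one]
      _ ≤ #(rootResidues g e) := by exact_mod_cast card_le_card inter_subset_left
      _ = polyRootCountMod ![g] e := by rw [card_rootResidues]
  have hS0 : 0 ≤ ∑ n ∈ Icc 1 x, locWeight g Δ e n := sum_nonneg fun n _ => locWeight_nonneg g Δ e n
  have hS : ∑ n ∈ Icc 1 x, locWeight g Δ e n ≤ x := by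
    calc ∑ n ∈ Icc 1 x, locWeight g Δ e n ≤ ∑ n ∈ Icc 1 x, (1 : ℝ) :=
          sum_le_sum fun n _ => locWeight_le_one g Δ e n
      _ = x := by rw [sum_const, Nat.card_Icc, nsmul_eq_mul, mul_one]; push_cast; ring
  have he : (0 : ℝ) < e := by exact_mod_cast (show 0 < e by omega)
  have hρ0 : (0 : ℝ) ≤ polyRootCountMod ![g] e := Nat.cast_nonneg _
  have hB0 : 0 ≤ (polyRootCountMod ![g] e : ℝ) / e * ∑ n ∈ Icc 1 x, locWeight g Δ e n := by positivity
  have hB : (polyRootCountMod ![g] e : ℝ) / e * ∑ n ∈ Icc 1 x, locWeight g Δ e n ≤ polyRootCountMod ![g] e := by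
    calc (polyRootCountMod ![g] e : ℝ) / e * ∑ n ∈ Icc 1 x, locWeight g Δ e n
        ≤ (polyRootCountMod ![g] e : ℝ) / e * e := by
          refine mul_le_mul_of_nonneg_left (hS.trans ?_) (by positivity)
          exact_mod_cast hxe.le
      _ = polyRootCountMod ![g] e := by field_simp
  rw [abs_le]
  constructor <;> linarith

/-! ### Averaging over the cut-off -/

/-- **Fubini for the trapezoid**: `∑_{X₀<x'≤X₀+D} ∑_{ν ∈ S ∩ [1,x']} a(ν) = ∑_{ν ∈ S ∩ [1,X₀+D]} W(ν)a(ν)`.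
[this work] -/
theorem sum_Ioc_sum_inter_Icc_eq (S : Finset ℕ) (a : ℕ → ℝ) (X₀ D : ℕ) :
    ∑ x' ∈ Ioc X₀ (X₀ + D), ∑ ν ∈ S ∩ Icc 1 x', a ν
      = ∑ ν ∈ S ∩ Icc 1 (X₀ + D), (trapCount X₀ D ν : ℝ) * a ν := by
  have h1 : ∀ x' ∈ Ioc X₀ (X₀ + D),
      ∑ ν ∈ S ∩ Icc 1 x', a ν = ∑ ν ∈ S ∩ Icc 1 (X₀ + D), if ν ≤ x' then a ν else 0 := by
    intro x' hx'
    have hx'' := (mem_Ioc.mp hx').2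
    rw [← sum_filter]
    congr 1
    ext ν
    simp only [mem_inter, mem_Icc, mem_filter]
    constructor
    · rintro ⟨hS, h1, h2⟩
      exact ⟨⟨hS, h1, h2.trans hx''⟩, h2⟩
    · rintro ⟨⟨hS, h1, -⟩, h2⟩
      exact ⟨hS, h1, h2⟩
  rw [sum_congr rfl h1, sum_comm]
  refine sum_congr rfl fun ν _ => ?_
  rw [← sum_filter, sum_const, nsmul_eq_mul, trapCount]

/-- The same with `S = [1, X₀+D]`: `∑_{X₀<x'≤X₀+D} ∑_{n≤x'} a(n) = ∑_{n≤X₀+D} W(n)a(n)`. [this work] -/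
theorem sum_Ioc_sum_Icc_eq (a : ℕ → ℝ) (X₀ D : ℕ) :
    ∑ x' ∈ Ioc X₀ (X₀ + D), ∑ n ∈ Icc 1 x', a n = ∑ n ∈ Icc 1 (X₀ + D), (trapCount X₀ D n : ℝ) * a n := by
  have h := sum_Ioc_sum_inter_Icc_eq (Icc 1 (X₀ + D)) a X₀ D
  rw [inter_self] at h
  rw [← h]
  refine sum_congr rfl fun x' hx' => ?_
  congr 1
  rw [eq_comm, inter_eq_right]
  exact Icc_subset_Icc_right (mem_Ioc.mp hx').2

/-- The LOW-MODULI part `Low = ∑_{X₀<x'≤X₁} ∑_{x'<e≤X₁} t_e(x')` (`X₁ = X₀ + D`). [this work] -/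
noncomputable def trapLow (g : ℤ[X]) (Δ : ℝ) (X₀ D : ℕ) : ℝ :=
  ∑ x' ∈ Ioc X₀ (X₀ + D), ∑ e ∈ Ioc x' (X₀ + D), levelTerm g Δ e x'

/-- The averaged level term `t^W_e = ∑_{ν ∈ R_e ∩ [1,X₁]} W(ν)a_e(ν) − (ρ_g(e)/e)∑_{m ≤ X₁} W(m)a_e(m)`.
[this work] -/
noncomputable def trapLevel (g : ℤ[X]) (Δ : ℝ) (X₀ D e : ℕ) : ℝ :=
  ∑ ν ∈ rootResidues g e ∩ Icc 1 (X₀ + D), (trapCount X₀ D ν : ℝ) * locWeight g Δ e ν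
    - (polyRootCountMod ![g] e : ℝ) / e * ∑ m ∈ Icc 1 (X₀ + D), (trapCount X₀ D m : ℝ) * locWeight g Δ e m

/-- `|Low| ≤ D·∑_{e ≤ X₀+D} ρ_g(e)`. [this work] -/
theorem abs_trapLow_le (g : ℤ[X]) (Δ : ℝ) (X₀ D : ℕ) :
    |trapLow g Δ X₀ D| ≤ (D : ℝ) * ∑ e ∈ Icc 1 (X₀ + D), (polyRootCountMod ![g] e : ℝ) := by
  unfold trapLow
  calc |∑ x' ∈ Ioc X₀ (X₀ + D), ∑ e ∈ Ioc x' (X₀ + D), levelTerm g Δ e x'|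
      ≤ ∑ x' ∈ Ioc X₀ (X₀ + D), |∑ e ∈ Ioc x' (X₀ + D), levelTerm g Δ e x'| := abs_sum_le_sum_abs _ _
    _ ≤ ∑ x' ∈ Ioc X₀ (X₀ + D), ∑ e ∈ Ioc x' (X₀ + D), |levelTerm g Δ e x'| :=
        sum_le_sum fun _ _ => abs_sum_le_sum_abs _ _
    _ ≤ ∑ x' ∈ Ioc X₀ (X₀ + D), ∑ e ∈ Ioc x' (X₀ + D), (polyRootCountMod ![g] e : ℝ) :=
        sum_le_sum fun x' _ => sum_le_sum fun e he => abs_levelTerm_le g Δ (mem_Ioc.mp he).1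
    _ ≤ ∑ x' ∈ Ioc X₀ (X₀ + D), ∑ e ∈ Icc 1 (X₀ + D), (polyRootCountMod ![g] e : ℝ) := by
        refine sum_le_sum fun x' _ => sum_le_sum_of_subset_of_nonneg (fun e he => ?_) fun _ _ _ => by positivity
        rw [mem_Ioc] at he
        rw [mem_Icc]
        omega
    _ = (D : ℝ) * ∑ e ∈ Icc 1 (X₀ + D), (polyRootCountMod ![g] e : ℝ) := by
        rw [sum_const, Nat.card_Ioc, Nat.add_sub_cancel_left, nsmul_eq_mul]

/-- **The averaging identity**: for `E ≥ X₁ = X₀ + D` admissible (`|g(n)| ≤ E` for `n ≤ X₁`),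
`∑_{X₀<x'≤X₁} (Mid^w_g(x') − H^w_g(x'; E)) = Low + ∑_{X₁<e≤E} t^W_e`. [this work] -/
theorem sum_Ioc_smooth_sub_heur_eq (g : ℤ[X]) (Δ : ℝ) {X₀ D E : ℕ}
    (hg0 : ∀ n ∈ Icc 1 (X₀ + D), g.eval (n : ℤ) ≠ 0) (hE : ∀ n ∈ Icc 1 (X₀ + D), (g.eval (n : ℤ)).natAbs ≤ E)
    (hXE : X₀ + D ≤ E) :
    ∑ x' ∈ Ioc X₀ (X₀ + D), (polySmoothMid g Δ x' - polySmoothHeur g Δ x' E)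
      = trapLow g Δ X₀ D + ∑ e ∈ Ioc (X₀ + D) E, trapLevel g Δ X₀ D e := by
  have hx : ∀ x' ∈ Ioc X₀ (X₀ + D), polySmoothMid g Δ x' - polySmoothHeur g Δ x' E
      = ∑ e ∈ Ioc x' (X₀ + D), levelTerm g Δ e x' + ∑ e ∈ Ioc (X₀ + D) E, levelTerm g Δ e x' := by
    intro x' hx'
    have hx'' := (mem_Ioc.mp hx').2
    have hsub : Icc 1 x' ⊆ Icc 1 (X₀ + D) := Icc_subset_Icc_right hx''
    rw [polySmoothMid_sub_heur_eq_sum_levelTerm g Δ (fun n hn => hg0 n (hsub hn)) (fun n hn => hE n (hsub hn)),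
      sum_Ioc_consecutive _ hx'' hXE]
  rw [sum_congr rfl hx, sum_add_distrib, trapLow, sum_comm]
  congr 1
  refine sum_congr rfl fun e _ => ?_
  unfold levelTerm trapLevel
  rw [sum_sub_distrib, sum_Ioc_sum_inter_Icc_eq, ← mul_sum, sum_Ioc_sum_Icc_eq]

/-- **The averaged level term in UNSHIFTED Hooley sums**: for `e > X₁`,
`t^W_e = e⁻¹ ∑_{0<h<e} K_e(h)·S_g(h; e)`. [this work] -/
theorem trapLevel_eq_fourier (g : ℤ[X]) (Δ : ℝ) {X₀ D e : ℕ} (he : X₀ + D < e) :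
    ((trapLevel g Δ X₀ D e : ℝ) : ℂ)
      = (1 / (e : ℂ)) * ∑ h ∈ Ico 1 e, trapKernel g Δ X₀ D e h * hooleySum g e h := by
  have he0' : 0 < e := by omega
  have he0 : (e : ℂ) ≠ 0 := by exact_mod_cast he0'.ne'
  have hB : ∀ m ∈ Icc 1 (X₀ + D), m < e := fun m hm => (mem_Icc.mp hm).2.trans_lt he
  have hid := sum_weightKernel_mul_charSum_eq
    (fun m => (((trapCount X₀ D m : ℝ) * locWeight g Δ e m : ℝ) : ℂ)) (rootResidues_lt g e) hB
  rw [range_eq_Ico, sum_eq_sum_Ico_succ_bot he0'] at hid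
  simp only [Nat.cast_zero, zero_mul, neg_zero, eAdd_zero, mul_one, sum_const, nsmul_eq_mul, mul_one,
    card_rootResidues] at hid
  have hid' : ∑ h ∈ Ico 1 e, trapKernel g Δ X₀ D e h * hooleySum g e h
      = (e : ℂ) * ∑ ν ∈ rootResidues g e ∩ Icc 1 (X₀ + D), (((trapCount X₀ D ν : ℝ) * locWeight g Δ e ν : ℝ) : ℂ)
        - (∑ m ∈ Icc 1 (X₀ + D), (((trapCount X₀ D m : ℝ) * locWeight g Δ e m : ℝ) : ℂ))
          * polyRootCountMod ![g] e := by
    rw [← hid]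
    unfold trapKernel hooleySum
    ring
  rw [hid', trapLevel]
  push_cast
  field_simp

/-- **The averaged located form, bounded**: for `E ≥ X₁ = X₀ + D` admissible,
`|∑_{X₀<x'≤X₁} (Mid^w_g(x') − H^w_g(x'; E))| ≤ D·∑_{e≤X₁} ρ_g(e) + |∑_{X₁<e≤E} e⁻¹∑_{0<h<e} K_e(h) S_g(h; e)|`.
[this work] -/
theorem abs_sum_Ioc_smooth_sub_heur_le (g : ℤ[X]) (Δ : ℝ) {X₀ D E : ℕ}
    (hg0 : ∀ n ∈ Icc 1 (X₀ + D), g.eval (n : ℤ) ≠ 0) (hE : ∀ n ∈ Icc 1 (X₀ + D), (g.eval (n : ℤ)).natAbs ≤ E)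
    (hXE : X₀ + D ≤ E) :
    |∑ x' ∈ Ioc X₀ (X₀ + D), (polySmoothMid g Δ x' - polySmoothHeur g Δ x' E)|
      ≤ (D : ℝ) * ∑ e ∈ Icc 1 (X₀ + D), (polyRootCountMod ![g] e : ℝ)
        + ‖∑ e ∈ Ioc (X₀ + D) E, (1 / (e : ℂ)) * ∑ h ∈ Ico 1 e, trapKernel g Δ X₀ D e h * hooleySum g e h‖ := by
  rw [sum_Ioc_smooth_sub_heur_eq g Δ hg0 hE hXE]
  have hZ : ((∑ e ∈ Ioc (X₀ + D) E, trapLevel g Δ X₀ D e : ℝ) : ℂ)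
      = ∑ e ∈ Ioc (X₀ + D) E, (1 / (e : ℂ)) * ∑ h ∈ Ico 1 e, trapKernel g Δ X₀ D e h * hooleySum g e h := by
    rw [Complex.ofReal_sum]
    exact sum_congr rfl fun e he => trapLevel_eq_fourier g Δ (mem_Ioc.mp he).1
  refine (abs_add_le _ _).trans (add_le_add (abs_trapLow_le g Δ X₀ D) (le_of_eq ?_))
  rw [← Real.norm_eq_abs, ← Complex.norm_real, hZ]

end Summit.Parity.BatemanHorn.Theorems
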